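import Summits.Ventures.PercRepro.RankLevelSetCoreSixColoopFree
import Summits.Ventures.PercRepro.RankLevelSetFourCircuitNullityFourSharp
import Summits.Ventures.PercRepro.RankLevelSetFiveCircuitNullityFourSharp
import Summits.Ventures.PercRepro.RankLevelSetSixCircuitAvg
import Summits.Ventures.PercRepro.RankLevelSetSevenCircuitAvg
import Summits.Ventures.PercRepro.S1Lever
import Summits.Ventures.PercRepro.S1CoreCapThirtyTwo
import Summits.Ventures.PercRepro.TriangleCapEightI

/-!
# PercRepro — THE CAP GLUE OF THE 25 ROW: THE COLOOP-FREE AVERAGING STEPS WITH THE POINT COUNT AS A NUMERAL, AND THE CELL WEIGHTS (p8 g9, S3)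

`proofs/SUBCLAIM-S3-p8.md` §3w. The coloop-free steps `s_k − ⌊k·s_k/m⌋ ≤ B` (p2's / g7's / g8's `…_sub_div_le_of_nonColoops` for `k = 3, 4, 5, 6, 7`, on the chains `avgChain14` (d3342) / `avgChain5c` and the crude `C(d + k − 1, k)`) packaged with the point count `m` and the target `K` as numerals (`hK` decided by `omega`), the coloop-free triangle step bounded for every `n ≥ n₀`, and the weights `Φ(p, 6) ≤ 2^{p+6}/C(p+6, 6)`, `Φ(p+2, 6)/4 ≤ 2^{p+6}/C(p+8, 6)` of the honest and the twice-scaled cells. Axioms: standard.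
-/

open scoped Matroid

namespace PercRepro

namespace ThmN

open Set

variable {α : Type}

/-- **The coloop-free triangle step, bounded for every `n ≥ n₀`**: on a coloop-free core of nullity `d + 1` with `n ≥ n₀ ≥ 4` points,
`s₃ ≤ ⌊n·cq3(d)/(n − 3)⌋ ≤ K` whenever `⌊n₀·cq3(d)/(n₀ − 3)⌋ ≤ K`, `(n₀ + 1)·cq3(d) ≤ (n₀ − 2)·K + (n₀ − 3)` and `cq3(d) ≤ K + 1`
(p2's `S1.ncard_triangles_le_of_coloopFree`, S1Lever; the quotient `n/(n − 3)` decreases in `n`). -/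
theorem s3_cf_of (M : Matroid α) [M.Finite]
    (hfree : ∀ e ∈ M.E, ∃ A ⊆ M.E \ {e}, e ∉ M.closure A ∧ e ∉ M.closure ((M.E \ {e}) \ A))
    (hcf : ∀ e ∈ M.E, ¬ M.IsColoop e) {d : ℕ} (hd : M.E.encard = M.eRank + ((d + 1 : ℕ) : ℕ∞))
    (n₀ K : ℕ) (hn0 : 4 ≤ n₀) (hn : n₀ ≤ M.E.ncard) (h1 : n₀ * TriangleCap.cq3 d / (n₀ - 3) ≤ K)
    (h2 : (n₀ + 1) * TriangleCap.cq3 d ≤ (n₀ - 2) * K + (n₀ - 3)) (h3 : TriangleCap.cq3 d ≤ K + 1) :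
    {C : Set α | M.IsCircuit C ∧ C.ncard = 3}.ncard ≤ K := by
  have h := S1.ncard_triangles_le_of_coloopFree M hfree hd (coloops_eq_empty_of_forall M hcf) rfl (by omega)
  rcases Nat.eq_or_lt_of_le hn with heq | hlt
  · rw [← heq] at h; exact h.trans h1
  · refine h.trans ((Nat.div_le_iff_le_mul_add_pred (by omega)).2 ?_)
    obtain ⟨m, rfl⟩ : ∃ m, n₀ = m + 3 := ⟨n₀ - 3, by omega⟩
    obtain ⟨t, ht⟩ : ∃ t, M.E.ncard = m + 4 + t := ⟨M.E.ncard - (m + 4), by omega⟩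
    rw [ht, show m + 4 + t - 3 = m + 1 + t by omega, show m + 1 + t - 1 = m + t by omega]
    rw [show m + 3 - 2 = m + 1 by omega, show m + 3 - 3 = m by omega] at h2
    nlinarith [h2, h3, Nat.mul_le_mul_left t h3]

/-- **The coloop-free 4-circuit step on `avgChain14`, bounded**: on a coloop-free core of nullity `d + 1` with `≥ m` points,
`s₄ − ⌊4·s₄/m⌋ ≤ avgChain14 d = B` (p2's `S1.ncard_fourCircuits_sub_div_le_of_nonColoops`), hence `s₄ ≤ K` when `K ≥ ⌊m·B/(m − 4)⌋`
(the hypothesis `hK : ∀ s, s − 4 * s / m ≤ B → s ≤ K` is decided by `omega` at numerals). -/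
theorem s4_cf_of (M : Matroid α) [M.Finite]
    (hfree : ∀ e ∈ M.E, ∃ A ⊆ M.E \ {e}, e ∉ M.closure A ∧ e ∉ M.closure ((M.E \ {e}) \ A))
    (hcf : ∀ e ∈ M.E, ¬ M.IsColoop e) {d : ℕ} (hd : M.E.encard = M.eRank + (d + 1)) (m B K : ℕ) (hm0 : 0 < m)
    (hm : m ≤ M.E.ncard) (hB : avgChain14 d = B) (hK : ∀ s, s - 4 * s / m ≤ B → s ≤ K) :
    {C : Set α | M.IsCircuit C ∧ C.ncard = 4}.ncard ≤ K := by
  have h := S1.ncard_fourCircuits_sub_div_le_of_nonColoops M hfree hd hm0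
    (by rw [ncard_nonColoops_eq_of_forall M hcf]; exact hm)
    (fun M' _ hfree' hd' => ncard_fourCircuits_le_avgChain14 d M' hfree' hd')
  rw [hB] at h
  exact hK _ h

/-- **The coloop-free 5-circuit step on `avgChain5c`, bounded** (`ncard_fiveCircuits_sub_div_le_of_nonColoops`, RankLevelSetCoreSixColoopFree,
on `S1.ncard_fiveCircuits_le_avgChain5c`). -/
theorem s5_cf_of (M : Matroid α) [M.Finite]
    (hfree : ∀ e ∈ M.E, ∃ A ⊆ M.E \ {e}, e ∉ M.closure A ∧ e ∉ M.closure ((M.E \ {e}) \ A))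
    (hcf : ∀ e ∈ M.E, ¬ M.IsColoop e) {d : ℕ} (hd : M.E.encard = M.eRank + (d + 1)) (m B K : ℕ) (hm0 : 0 < m)
    (hm : m ≤ M.E.ncard) (hB : S1.avgChain5c d = B) (hK : ∀ s, s - 5 * s / m ≤ B → s ≤ K) :
    {C : Set α | M.IsCircuit C ∧ C.ncard = 5}.ncard ≤ K := by
  have h := ncard_fiveCircuits_sub_div_le_of_nonColoops M hfree hd hm0
    (by rw [ncard_nonColoops_eq_of_forall M hcf]; exact hm)
    (fun M' _ hfree' hd' => S1.ncard_fiveCircuits_le_avgChain5c d M' hfree' hd')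
  rw [hB] at h
  exact hK _ h

/-- **The coloop-free 6-circuit step from the crude bound**: on a coloop-free core of nullity `d + 1` with `≥ m` points,
`s₆ − ⌊6·s₆/m⌋ ≤ C(d + 5, 6)` (`ncard_sixCircuits_sub_div_le_of_nonColoops`, RankLevelSetSixCircuitAvg, on night-1's
`ncard_circuits_le_choose_of_encard` at nullity `d`), hence `s₆ ≤ K`. -/
theorem s6_cf_of (M : Matroid α) [M.Finite]
    (hfree : ∀ e ∈ M.E, ∃ A ⊆ M.E \ {e}, e ∉ M.closure A ∧ e ∉ M.closure ((M.E \ {e}) \ A))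
    (hcf : ∀ e ∈ M.E, ¬ M.IsColoop e) {d : ℕ} (hd : M.E.encard = M.eRank + (d + 1)) (m B K : ℕ) (hm0 : 0 < m)
    (hm : m ≤ M.E.ncard) (hB : (d + 5).choose 6 = B) (hK : ∀ s, s - 6 * s / m ≤ B → s ≤ K) :
    {C : Set α | M.IsCircuit C ∧ C.ncard = 6}.ncard ≤ K := by
  have h := ncard_sixCircuits_sub_div_le_of_nonColoops M hfree hd hm0
    (by rw [ncard_nonColoops_eq_of_forall M hcf]; exact hm)
    (fun M' _ _ hd' => Matroid.ncard_circuits_le_choose_of_encard M' hd' 5)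
  rw [hB] at h
  exact hK _ h

/-- **The coloop-free 7-circuit step from the crude bound** (`ncard_sevenCircuits_sub_div_le_of_nonColoops`, RankLevelSetSevenCircuitAvg). -/
theorem s7_cf_of (M : Matroid α) [M.Finite]
    (hfree : ∀ e ∈ M.E, ∃ A ⊆ M.E \ {e}, e ∉ M.closure A ∧ e ∉ M.closure ((M.E \ {e}) \ A))
    (hcf : ∀ e ∈ M.E, ¬ M.IsColoop e) {d : ℕ} (hd : M.E.encard = M.eRank + (d + 1)) (m B K : ℕ) (hm0 : 0 < m)
    (hm : m ≤ M.E.ncard) (hB : (d + 6).choose 7 = B) (hK : ∀ s, s - 7 * s / m ≤ B → s ≤ K) :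
    {C : Set α | M.IsCircuit C ∧ C.ncard = 7}.ncard ≤ K := by
  have h := ncard_sevenCircuits_sub_div_le_of_nonColoops M hfree hd hm0
    (by rw [ncard_nonColoops_eq_of_forall M hcf]; exact hm)
    (fun M' _ _ hd' => Matroid.ncard_circuits_le_choose_of_encard M' hd' 6)
  rw [hB] at h
  exact hK _ h

/-- `Φ(p, 6) ≤ 2^{p+6}/C(p + 6, 6)` in the form the cells take (`phiK_le_two_pow_div`, `Nat.choose_symm_add`). -/
theorem phiK_le_two_pow_div_six (p : ℕ) : phiK p 6 ≤ (2 : ℚ) ^ (p + 6) / (((p + 6).choose 6 : ℕ) : ℚ) := by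
  have := phiK_le_two_pow_div p 6
  rwa [Nat.choose_symm_add] at this

/-- `Φ(p + 2, 6)/4 ≤ 2^{p+6}/C(p + 8, 6)`: the weight of the TWICE-scaled cell (two coloop deletions; `phiK_succ_div_two_le`). -/
theorem phiK_add_two_div_four_le (p : ℕ) :
    phiK (p + 2) 6 / 4 ≤ (2 : ℚ) ^ (p + 6) / (((p + 8).choose 6 : ℕ) : ℚ) := by
  have h := phiK_succ_div_two_le (p + 1) 6
  rw [show p + 1 + 1 + 6 = p + 8 by omega, show p + 1 + 6 = p + 6 + 1 by omega, pow_succ] at h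
  have hc : (0 : ℚ) < (((p + 8).choose 6 : ℕ) : ℚ) := by exact_mod_cast Nat.choose_pos (by omega)
  have h2 : phiK (p + 2) 6 / 4 = (phiK (p + 1 + 1) 6 / 2) / 2 := by ring
  rw [h2]
  calc phiK (p + 1 + 1) 6 / 2 / 2 ≤ (2 : ℚ) ^ (p + 6) * 2 / (((p + 8).choose 6 : ℕ) : ℚ) / 2 := by gcongr
    _ = (2 : ℚ) ^ (p + 6) / (((p + 8).choose 6 : ℕ) : ℚ) := by ring
end ThmN

end PercRepro
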